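import Summits.Ventures.PercRepro.MSTheoremS

/-!
# Every half of a tight family is tight

`MSTightLever.lean` / `MSTightLeverR.lean` show that the LARGER of the two halves
`part0 r F` (members avoiding `r`) and `partr r F` (members containing `r`, with `r` removed) of a
tight family is tight. Theorem S (`dichotomy_of_tight`) removes the size condition: the twin
class `q = cls F r` of `r` is removable or addable, and

* if `q` is removable, `t ↦ t \ q` injects `partr r F` into `part0 r F`, so the lever makes
  `part0 r F` tight and gives `|partr r F \\ part0 r F| = |partr r F|`; then
  `E ↦ E ∪ q.erase r` injects `partr r F \\ partr r F` into `partr r F \\ part0 r F`, so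
  `partr r F` is tight too (`tight_partr_of_closedRem`);
* if `q` is addable, `s ↦ (s ∪ q).erase r` injects `part0 r F` into `partr r F` and the same
  two steps run with the roles exchanged (`tight_part0_of_closedAdd`).

Hence **both halves of a tight family are tight, for every element `r`**
(`tight_part0_and_tight_partr`) — Corollary (iii) of proofs/MINE1-theoremS.md.
-/

namespace PercRepro.MSTight

open Finset
open scoped FinsetFamily

variable {α : Type*} [DecidableEq α]

/-- A set containing `q.erase r` and avoiding `r` is recovered from its part outside `q`. -/
theorem eq_sdiff_union_erase {q t : Finset α} {r : α} (h1 : q.erase r ⊆ t) (h2 : r ∉ t) :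
    t = t \ q ∪ q.erase r := by
  ext x
  have h1x : x ≠ r ∧ x ∈ q → x ∈ t := fun h => h1 (mem_erase.2 h)
  have h3 : x ∈ t → x ≠ r := fun hx hxr => h2 (hxr ▸ hx)
  simp only [mem_union, mem_sdiff, mem_erase]
  tauto

/-- A set avoiding `q ∋ r` is recovered from `(· ∪ q).erase r` by removing `q`. -/
theorem eq_erase_union_sdiff {q s : Finset α} {r : α} (hd : Disjoint q s) (hr : r ∈ q) :
    s = (s ∪ q).erase r \ q := by
  ext x
  have hx1 : x ∈ s → x ∉ q := fun hx hq => disjoint_left.1 hd hq hx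
  have hx2 : x ∈ s → x ≠ r := fun hx hxr => hx1 hx (hxr ▸ hr)
  simp only [mem_sdiff, mem_erase, mem_union]
  tauto

/-- A set avoiding `q.erase r` is recovered from `· ∪ q.erase r` by removing `q.erase r`. -/
theorem eq_union_sdiff_erase {q D : Finset α} {r : α} (hD : Disjoint D (q.erase r)) :
    D = (D ∪ q.erase r) \ q.erase r := by
  ext x
  have hx1 : x ∈ D → x ∉ q.erase r := fun hx hq => disjoint_left.1 hD hx hq
  simp only [mem_sdiff, mem_union]
  tauto

variable [Fintype α]

/-- A member containing `r`, with `r` removed, contains the rest of the class of `r`. -/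
theorem cls_erase_subset_of_mem_partr {F : Finset (Finset α)} {r : α} {t : Finset α}
    (ht : t ∈ partr r F) : (cls F r).erase r ⊆ t := by
  obtain ⟨_, hF⟩ := mem_partr.1 ht
  intro x hx
  obtain ⟨hxr, hxq⟩ := mem_erase.1 hx
  have := cls_subset_of_mem hF (mem_insert_self r t) hxq
  exact (mem_insert.1 this).resolve_left hxr

/-- A member avoiding `r` avoids the class of `r`. -/
theorem disjoint_cls_of_mem_part0 {F : Finset (Finset α)} {r : α} {s : Finset α}
    (hs : s ∈ part0 r F) : Disjoint (cls F r) s :=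
  disjoint_cls_of_notMem (mem_part0.1 hs).1 (mem_part0.1 hs).2

/-- Removable class: `(t \ t') ∪ q.erase r = t \ (t' \ q)` for `t, t' ∈ partr r F`. -/
theorem sdiff_union_erase_eq {F : Finset (Finset α)} {r : α} {t t' : Finset α} (ht : t ∈ partr r F)
    (ht' : t' ∈ partr r F) :
    t \ t' ∪ (cls F r).erase r = t \ (t' \ cls F r) := by
  have h1 := cls_erase_subset_of_mem_partr ht
  have h2 : r ∉ t := (mem_partr.1 ht).1
  have _h1' := cls_erase_subset_of_mem_partr ht'
  ext x
  have h1x : x ≠ r ∧ x ∈ cls F r → x ∈ t := fun h => h1 (mem_erase.2 h)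
  have h3 : x ∈ t → x ≠ r := fun hx hxr => h2 (hxr ▸ hx)
  simp only [mem_union, mem_sdiff, mem_erase]
  tauto

/-- Addable class: `(s \ s') ∪ q.erase r = (s ∪ q).erase r \ s'` for `s, s' ∈ part0 r F`. -/
theorem sdiff_union_erase_eq' {F : Finset (Finset α)} {r : α} {s s' : Finset α} (hs : s ∈ part0 r F)
    (hs' : s' ∈ part0 r F) :
    s \ s' ∪ (cls F r).erase r = (s ∪ cls F r).erase r \ s' := by
  have hd := disjoint_cls_of_mem_part0 hs
  have hd' := disjoint_cls_of_mem_part0 hs'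
  have hr : r ∉ s := (mem_part0.1 hs).2
  ext x
  have hx1 : x ∈ cls F r → x ∉ s' := fun hq' hx => disjoint_left.1 hd' hq' hx
  have hx2 : x ∈ s → x ∉ cls F r := fun hx hq' => disjoint_left.1 hd hq' hx
  have hx3 : x ∈ s → x ≠ r := fun hx hxr => hr (hxr ▸ hx)
  simp only [mem_union, mem_sdiff, mem_erase]
  tauto

section Removable

variable {F : Finset (Finset α)} {r : α} (hq : ClosedRem F (cls F r))
include hq

/-- Removable class: `t ↦ t \ cls F r` sends `partr r F` into `part0 r F`. -/
theorem sdiff_cls_mem_part0_of_mem_partr {t : Finset α} (ht : t ∈ partr r F) :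
    t \ cls F r ∈ part0 r F := by
  obtain ⟨_, hF⟩ := mem_partr.1 ht
  have h := hq _ hF
  rw [insert_sdiff_of_mem _ (self_mem_cls F r)] at h
  exact mem_part0.2 ⟨h, fun hx => (mem_sdiff.1 hx).2 (self_mem_cls F r)⟩

/-- Removable class: at most as many members contain `r` as avoid it. -/
theorem card_partr_le_card_part0_of_closedRem : (partr r F).card ≤ (part0 r F).card := by
  refine card_le_card_of_injOn (fun t => t \ cls F r)
    (fun t ht => sdiff_cls_mem_part0_of_mem_partr hq ht) ?_
  intro t ht t' ht' h
  have ht₁ : t ∈ partr r F := mem_coe.1 ht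
  have ht₁' : t' ∈ partr r F := mem_coe.1 ht'
  rw [eq_sdiff_union_erase (cls_erase_subset_of_mem_partr ht₁) (mem_partr.1 ht₁).1,
    eq_sdiff_union_erase (cls_erase_subset_of_mem_partr ht₁') (mem_partr.1 ht₁').1]
  simp only at h
  rw [h]

/-- Removable class: the `r`-free half is tight. -/
theorem tight_part0_of_closedRem (hF : Tight F) : Tight (part0 r F) :=
  (tight_part0_of_card_le hF r (card_partr_le_card_part0_of_closedRem hq)).1

/-- Removable class: the `r`-half is tight. -/
theorem tight_partr_of_closedRem (hF : Tight F) : Tight (partr r F) := by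
  have hY : (diffsY r F).card = (partr r F).card :=
    (card_diffsX_eq_card_part0_of_card_le hF r (card_partr_le_card_part0_of_closedRem hq)).2
  have hdisj : ∀ D ∈ partr r F \\ partr r F, Disjoint D ((cls F r).erase r) := by
    intro D hD
    obtain ⟨t, _, t', ht', rfl⟩ := mem_diffs.1 hD
    have h1 := cls_erase_subset_of_mem_partr ht'
    exact disjoint_left.2 fun x hx hxq => (mem_sdiff.1 hx).2 (h1 hxq)
  have hle : (partr r F \\ partr r F).card ≤ (diffsY r F).card := by
    refine card_le_card_of_injOn (fun E => E ∪ (cls F r).erase r) ?_ ?_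
    · intro E hE
      obtain ⟨t, ht, t', ht', rfl⟩ := mem_diffs.1 (mem_coe.1 hE)
      refine mem_diffs.2 ⟨t, ht, t' \ cls F r, sdiff_cls_mem_part0_of_mem_partr hq ht', ?_⟩
      exact (sdiff_union_erase_eq ht ht').symm
    · intro E hE E' hE' h
      rw [eq_union_sdiff_erase (hdisj E (mem_coe.1 hE)),
        eq_union_sdiff_erase (hdisj E' (mem_coe.1 hE'))]
      simp only at h
      rw [h]
  have hMS := Finset.card_le_card_diffs (partr r F)
  exact le_antisymm (hle.trans hY.le) hMS

end Removable

section Addable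

variable {F : Finset (Finset α)} {r : α} (hq : ClosedAdd F (cls F r))
include hq

/-- Addable class: `s ↦ (s ∪ cls F r).erase r` sends `part0 r F` into `partr r F`. -/
theorem union_cls_erase_mem_partr_of_mem_part0 {s : Finset α} (hs : s ∈ part0 r F) :
    (s ∪ cls F r).erase r ∈ partr r F := by
  obtain ⟨hF, _⟩ := mem_part0.1 hs
  refine mem_partr.2 ⟨notMem_erase r _, ?_⟩
  rw [insert_erase (mem_union.2 (Or.inr (self_mem_cls F r)))]
  exact hq _ hF

/-- Addable class: at least as many members contain `r` as avoid it. -/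
theorem card_part0_le_card_partr_of_closedAdd : (part0 r F).card ≤ (partr r F).card := by
  refine card_le_card_of_injOn (fun s => (s ∪ cls F r).erase r)
    (fun s hs => union_cls_erase_mem_partr_of_mem_part0 hq hs) ?_
  intro s hs s' hs' h
  rw [eq_erase_union_sdiff (disjoint_cls_of_mem_part0 (mem_coe.1 hs)) (self_mem_cls F r),
    eq_erase_union_sdiff (disjoint_cls_of_mem_part0 (mem_coe.1 hs')) (self_mem_cls F r)]
  simp only at h
  rw [h]

/-- Addable class: the `r`-half is tight. -/
theorem tight_partr_of_closedAdd (hF : Tight F) : Tight (partr r F) :=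
  (tight_partr_of_card_le hF r (card_part0_le_card_partr_of_closedAdd hq)).1

/-- Addable class: the `r`-free half is tight. -/
theorem tight_part0_of_closedAdd (hF : Tight F) : Tight (part0 r F) := by
  have hY : (diffsY r F).card = (part0 r F).card :=
    (card_diffsX_eq_card_partr_of_card_le hF r (card_part0_le_card_partr_of_closedAdd hq)).2
  have hdisj : ∀ D ∈ part0 r F \\ part0 r F, Disjoint D ((cls F r).erase r) := by
    intro D hD
    obtain ⟨s, hs, _, _, rfl⟩ := mem_diffs.1 hD
    have hd := disjoint_cls_of_mem_part0 hs
    exact disjoint_left.2 fun x hx hxq =>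
      disjoint_left.1 hd (mem_erase.1 hxq).2 (mem_sdiff.1 hx).1
  have hle : (part0 r F \\ part0 r F).card ≤ (diffsY r F).card := by
    refine card_le_card_of_injOn (fun E => E ∪ (cls F r).erase r) ?_ ?_
    · intro E hE
      obtain ⟨s, hs, s', hs', rfl⟩ := mem_diffs.1 (mem_coe.1 hE)
      refine mem_diffs.2 ⟨(s ∪ cls F r).erase r, union_cls_erase_mem_partr_of_mem_part0 hq hs,
        s', hs', ?_⟩
      exact (sdiff_union_erase_eq' hs hs').symm
    · intro E hE E' hE' h
      rw [eq_union_sdiff_erase (hdisj E (mem_coe.1 hE)),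
        eq_union_sdiff_erase (hdisj E' (mem_coe.1 hE'))]
      simp only at h
      rw [h]
  have hMS := Finset.card_le_card_diffs (part0 r F)
  exact le_antisymm (hle.trans hY.le) hMS

end Addable

/-- **Both halves of a tight family are tight**, for every element `r`. -/
theorem tight_part0_and_tight_partr {F : Finset (Finset α)} (hF : Tight F) (r : α) :
    Tight (part0 r F) ∧ Tight (partr r F) := by
  rcases dichotomy_of_tight hF r with hq | hq
  · exact ⟨tight_part0_of_closedAdd hq hF, tight_partr_of_closedAdd hq hF⟩
  · exact ⟨tight_part0_of_closedRem hq hF, tight_partr_of_closedRem hq hF⟩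

end PercRepro.MSTight
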